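import Mathlib.Analysis.SpecialFunctions.Log.NegMulLog
import Mathlib.Analysis.SpecialFunctions.Pow.Real
import Mathlib.Analysis.SpecialFunctions.Log.Base
import Mathlib.Analysis.MeanInequalities
import HarnessLib

/-!
# The entropy trick (CVZ Lemma 3.12): `h(p) + p a + (1 - p) b ≤ log₂(2^a + 2^b)` for every `p ∈ [0,1]`

Topic `Literature/Computability/AlgebraicComplexity`; a real-analysis lemma for the sub-additivity of the
(upper) quantum functional under direct sums, M. Christandl, P. Vrana, J. Zuiddam, *Universal points in
the asymptotic spectrum of tensors*, J. Amer. Math. Soc. 36 (2023) = arXiv:1709.07851v3, **Lemma 3.12**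
(quoting Strassen [Str91]): for real `a, b`,
`max_{0 ≤ p ≤ 1} [h(p) + p a + (1-p) b] = log₂(2^a + 2^b)`, `h` the binary entropy in bits. The value
at the maximiser `p = 2^a/(2^a + 2^b)` is the tree's `negMulLog_weights_add_eq_logb`
(`QuantumFunctionalsDirectSum.lean`, used for the super-additivity Lemma 3.22); this file PROVES the
inequality for every `p ∈ [0,1]` (`negMulLog_weights_add_le_logb`), which is the form in which Lemma 3.12
enters the sub-additivity Lemma 3.11 (`E^θ(s ⊕ t) ≤ max_p [p E^θ(s) + (1-p) E^θ(t) + h(p)]`, hence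
`F^θ(s ⊕ t) ≤ F^θ(s) + F^θ(t)`), together with the exponential form
`2^{h(p) + p a + (1-p) b} ≤ 2^a + 2^b` (`two_rpow_negMulLog_weights_add_le`).

Proof: for `0 < p < 1` the weighted AM–GM inequality (Mathlib's `Real.geom_mean_le_arith_mean2_weighted`)
gives `(2^a/p)^p (2^b/(1-p))^{1-p} ≤ p · 2^a/p + (1-p) · 2^b/(1-p) = 2^a + 2^b`, and `log₂` of the
left-hand side is `h(p) + p a + (1-p) b`; the endpoints `p = 0, 1` are immediate. (Equivalently: the
binary relative entropy `D(p ‖ 2^a/(2^a+2^b)) ≥ 0`.)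

## References

* M. Christandl, P. Vrana, J. Zuiddam, J. Amer. Math. Soc. 36 (2023) 31–79 = arXiv:1709.07851v3,
  Lemma 3.11, Lemma 3.12. [ChristandlVranaZuiddam2023]
* V. Strassen, *Degeneration and complexity of bilinear maps: some asymptotic spectra*,
  J. reine angew. Math. 413 (1991) 127–180 (the source of Lemma 3.12 as cited by CVZ).

No definitions, no named facts. Mathlib: `Real.geom_mean_le_arith_mean2_weighted`, `Real.negMulLog`,
`Real.logb` (`logb_le_logb`, `logb_mul`, `logb_div`, `logb_rpow_eq_mul_logb_of_pos`, `logb_rpow`).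
-/

noncomputable section

open Real (negMulLog)

namespace Literature.Computability.AlgebraicComplexity

/-- **CVZ Lemma 3.12 (entropy trick), inequality form**: for real `a, b` and `0 ≤ p ≤ 1`,
`h(p) + p a + (1-p) b ≤ log₂(2^a + 2^b)`, with `h(p) = (η(p) + η(1-p))/log 2` the binary entropy in
bits (`η = negMulLog`). [cite: ChristandlVranaZuiddam2023, Lemma 3.12] -/
theorem negMulLog_weights_add_le_logb (a b : ℝ) {p : ℝ} (hp0 : 0 ≤ p) (hp1 : p ≤ 1) :
    (negMulLog p + negMulLog (1 - p)) / Real.log 2 + p * a + (1 - p) * b ≤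
      Real.logb 2 ((2 : ℝ) ^ a + (2 : ℝ) ^ b) := by
  have hA : (0 : ℝ) < 2 ^ a := Real.rpow_pos_of_pos two_pos a
  have hB : (0 : ℝ) < 2 ^ b := Real.rpow_pos_of_pos two_pos b
  have hS : (0 : ℝ) < 2 ^ a + 2 ^ b := add_pos hA hB
  have hl2 : 0 < Real.log 2 := Real.log_pos one_lt_two
  have hla : Real.logb 2 ((2 : ℝ) ^ a) = a := Real.logb_rpow two_pos (by norm_num)
  have hlb : Real.logb 2 ((2 : ℝ) ^ b) = b := Real.logb_rpow two_pos (by norm_num)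
  rcases hp0.eq_or_lt with rfl | hp0'
  · -- `p = 0`: the left-hand side is `b`
    simp only [Real.negMulLog_zero, sub_zero, Real.negMulLog_one, add_zero, zero_div, zero_mul,
      zero_add, one_mul]
    calc b = Real.logb 2 ((2 : ℝ) ^ b) := hlb.symm
      _ ≤ Real.logb 2 ((2 : ℝ) ^ a + (2 : ℝ) ^ b) :=
          Real.logb_le_logb_of_le one_lt_two hB (le_add_of_nonneg_left hA.le)
  rcases hp1.eq_or_lt with rfl | hp1'
  · -- `p = 1`: the left-hand side is `a`
    simp only [Real.negMulLog_one, sub_self, Real.negMulLog_zero, add_zero, zero_div, one_mul,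
      zero_mul, zero_add]
    calc a = Real.logb 2 ((2 : ℝ) ^ a) := hla.symm
      _ ≤ Real.logb 2 ((2 : ℝ) ^ a + (2 : ℝ) ^ b) :=
          Real.logb_le_logb_of_le one_lt_two hA (le_add_of_nonneg_right hB.le)
  -- `0 < p < 1`: weighted AM–GM
  have hq0 : 0 < 1 - p := sub_pos.2 hp1'
  have hX : 0 < (2 : ℝ) ^ a / p := div_pos hA hp0'
  have hY : 0 < (2 : ℝ) ^ b / (1 - p) := div_pos hB hq0
  have amgm := Real.geom_mean_le_arith_mean2_weighted hp0 hq0.le hX.le hY.le (by ring)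
  have hrhs : p * ((2 : ℝ) ^ a / p) + (1 - p) * ((2 : ℝ) ^ b / (1 - p)) = (2 : ℝ) ^ a + (2 : ℝ) ^ b := by
    field_simp
  rw [hrhs] at amgm
  have hpos : 0 < ((2 : ℝ) ^ a / p) ^ p * ((2 : ℝ) ^ b / (1 - p)) ^ (1 - p) :=
    mul_pos (Real.rpow_pos_of_pos hX p) (Real.rpow_pos_of_pos hY (1 - p))
  have hlog := Real.logb_le_logb_of_le one_lt_two hpos amgm
  -- `log₂` of the geometric mean is the left-hand side
  have hlhs : Real.logb 2 (((2 : ℝ) ^ a / p) ^ p * ((2 : ℝ) ^ b / (1 - p)) ^ (1 - p)) =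
      (negMulLog p + negMulLog (1 - p)) / Real.log 2 + p * a + (1 - p) * b := by
    rw [Real.logb_mul (Real.rpow_pos_of_pos hX p).ne' (Real.rpow_pos_of_pos hY (1 - p)).ne',
      Real.logb_rpow_eq_mul_logb_of_pos hX, Real.logb_rpow_eq_mul_logb_of_pos hY,
      Real.logb_div hA.ne' hp0'.ne',
      Real.logb_div hB.ne' hq0.ne', hla, hlb, Real.negMulLog, Real.negMulLog, Real.logb, Real.logb]
    field_simp
    ring
  rw [hlhs] at hlog
  exact hlog

/-- **CVZ Lemma 3.12, exponential form**: `2^{h(p) + p a + (1-p) b} ≤ 2^a + 2^b` for `0 ≤ p ≤ 1`.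
[cite: ChristandlVranaZuiddam2023, Lemma 3.12] -/
theorem two_rpow_negMulLog_weights_add_le (a b : ℝ) {p : ℝ} (hp0 : 0 ≤ p) (hp1 : p ≤ 1) :
    (2 : ℝ) ^ ((negMulLog p + negMulLog (1 - p)) / Real.log 2 + p * a + (1 - p) * b) ≤
      (2 : ℝ) ^ a + (2 : ℝ) ^ b := by
  have hS : (0 : ℝ) < 2 ^ a + 2 ^ b :=
    add_pos (Real.rpow_pos_of_pos two_pos a) (Real.rpow_pos_of_pos two_pos b)
  have h := negMulLog_weights_add_le_logb a b hp0 hp1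
  calc (2 : ℝ) ^ ((negMulLog p + negMulLog (1 - p)) / Real.log 2 + p * a + (1 - p) * b)
      ≤ (2 : ℝ) ^ Real.logb 2 ((2 : ℝ) ^ a + (2 : ℝ) ^ b) :=
        Real.rpow_le_rpow_of_exponent_le one_le_two h
    _ = (2 : ℝ) ^ a + (2 : ℝ) ^ b := Real.rpow_logb two_pos (by norm_num) hS

end Literature.Computability.AlgebraicComplexity

end
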